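import Literature.Probability.Percolation.ArmSeparationWhite
import Literature.Probability.Percolation.ArmSeparationRingIndex
import HarnessLib

/-!
# Slots of the landing step: parameters, routing and events

Topic: Probability / Percolation; family `crit-perc`. A brick of the discharge of
`Literature.Probability.Percolation.Nolin2008_twoArm_separation` (Nolin 2008, Thm. 11
[arXiv 0711.4948: Thm. 10], `j = 2`, `σ = BW`; `ArmSeparation.lean`), landing step of the internal
extremities (Nolin 2008, Prop. 12 (iii)–(i) [arXiv Prop. 11]: "there exists some landing
sequence … where the probability of landing is comparable to the probability of just being
well-separated"; the sum over the finitely many positions of the tips is the constant `C₁(η')`).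
The tiny-fenced two-arm event `IntTinyExt m N k₀ K R₀` (`ArmSeparationIntSurgery.lean`) is
decomposed according to the **slot** of the two tips — side `io, ic < 6`, scale index `jo, jc < K`
and window index `no, nc` of the tip rows (windows of width `w = k₀/4`) — and to each slot are
attached the **corridor events** of the two landing moves (`landing_move`,
`white_landing_move`): beacon, spoke, an arc of a thin ring (radius `r_B ≈ m - μ` for the open
arm, `r_W ≈ m - 3μ` for the closed one, `μ = k₀ 32^K`), approach tube and target free space, with
the **routing** that keeps the two colours apart: the target row of each colour avoids the other
tip when that tip sits on the target's side (`Slot.bo`, `Slot.bc`), and each arc is the complement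
of the window of ring tubes that the other colour may touch (`Slot.loB/hiB`: the six tubes of ring `B`
that the white spoke may meet; `Slot.loW/hiW`: the tubes of ring `W` that the black target boxes may meet).
This file fixes the parameters (`LParams`), the routing functions and the four events of a slot
(`blackArm`, `whiteArm` — the tiny-fenced arms with tips in the slot; `blackCorr`, `whiteCorr` —
the corridors); the arithmetic of the routing, the separation and the probability estimates are in
the sequel files.

## References

* P. Nolin, *Near-critical percolation in two dimensions*, Electron. J. Probab. 13 (2008), §4.2
  Def. 6–8, §4.3 Prop. 12, §4.4 [arXiv 0711.4948: Def. 6–8, Prop. 11, Thm. 10]. [Nolin2008]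
* H. Kesten, *Scaling relations for 2D-percolation*, Comm. Math. Phys. 109 (1987), Lemma 2, §2. [Kesten1987]
-/

noncomputable section

open Set

namespace Literature.Probability.Percolation

open LatticeModels HalfAnnulus Tube

/-! ### Parameters of a rung -/

/-- **The parameters of one rung of the landing step**: current radius `m`, target radius `n`
(`m = 2n + 1` on the ladder), outer radius `N`, smallest fence scale `k₀`, number of scales `K`,
tip margin `R₀`. [cite: Nolin2008, §4.4 (arXiv 0711.4948: Thm. 10, internal extremities)] -/
structure LParams where
  /-- current radius -/
  m : ℕ
  /-- target radius -/
  n : ℕ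
  /-- outer radius -/
  N : ℕ
  /-- smallest fence scale -/
  k₀ : ℕ
  /-- number of fence scales -/
  K : ℕ
  /-- margin of the tips from the corners -/
  R₀ : ℕ

namespace LParams

variable (P : LParams)

/-- window width `w = k₀ / 4` [folklore] -/
def w : ℕ := P.k₀ / 4
/-- spoke half-width `ε = k₀ / 16` [folklore] -/
def ε : ℕ := P.k₀ / 16
/-- ring tube half-width `e = k₀ / 4` [folklore] -/
def e : ℕ := P.k₀ / 4
/-- ring chunk length `s = k₀` [folklore] -/
def s : ℕ := P.k₀
/-- depth unit `μ = k₀ 32^K` (exceeds `32 k` for every fence scale `k`) [folklore] -/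
def μ : ℕ := trapScale P.k₀ P.K
/-- radius of the ring of the open arm, a multiple of `s` in `(m - μ - s, m - μ]` [folklore] -/
def rB : ℕ := P.s * ((P.m - P.μ) / P.s)
/-- radius of the ring of the closed arm, a multiple of `s` in `(m - 3μ - s, m - 3μ]` [folklore] -/
def rW : ℕ := P.s * ((P.m - 3 * P.μ) / P.s)
/-- length of the spoke of the open arm [folklore] -/
def LB : ℕ := P.μ + 2 * P.s + 4 * P.e
/-- length of the spoke of the closed arm [folklore] -/
def LW : ℕ := 3 * P.μ + 2 * P.s + 4 * P.e
/-- width of the approach tube of the open arm: `n - n/8 + 1 + WB = rB + 2e` [folklore] -/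
def WB : ℕ := P.rB + 2 * P.e + P.n / 8 - 1 - P.n
/-- width of the approach tube of the closed arm [folklore] -/
def WW : ℕ := P.rW + 2 * P.e + P.n / 8 - 1 - P.n
/-- chunks per side of the ring of the open arm [folklore] -/
def nB : ℕ := P.rB / P.s
/-- chunks per side of the ring of the closed arm [folklore] -/
def nW : ℕ := P.rW / P.s
/-- number of windows of tip rows [folklore] -/
def Nw : ℕ := P.m / P.w + 1
/-- start of the `ν`-th window [folklore] -/
def T₀ (ν : ℕ) : ℤ := -(P.m : ℤ) + ν * P.w
/-- pieces in an exit run: `d s ≥ n/64 + 2s` [folklore] -/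
def d : ℕ := P.n / 64 / P.s + 3
/-- length of the arc of the open arm: the ring of the open arm minus a window of six tubes [folklore] -/
def lenB : ℕ := 12 * P.nB - 4 - 6

end LParams

/-! ### Ring positions -/

/-- The lateral index of the lateral position `ξ` on a ring of radius `r` with chunk `s`:
`⌊(ξ + r) / s⌋`. [folklore] -/
def latIdx (s r : ℕ) (ξ : ℤ) : ℕ := (ξ + r).toNat / s

/-- The offset of the block of the side `i` in the thin ring with `n` chunks per side. [folklore] -/
def blockOff (n i : ℕ) : ℕ :=
  match i with
  | 0 => 0
  | 1 => 2 * n - 1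
  | 2 => 4 * n - 1
  | 3 => 6 * n - 2
  | 4 => 8 * n - 3
  | 5 => 10 * n - 3
  | _ => 0

/-- The position in the thin ring of the piece of the side `i` with lateral index `ι` (on the
sides `2`, `5` the pieces are listed by decreasing lateral index). [folklore] -/
def piecePos (n i ι : ℕ) : ℕ := blockOff n i + (if i % 3 = 2 then 2 * (n - 1 - ι) else 2 * ι)

/-! ### Slots and routing -/

/-- **A slot**: side, scale index and window index of the open tip (`io, jo, no`) and of the closed
tip (`ic, jc, nc`). [cite: Nolin2008, §4.4 (arXiv 0711.4948: Thm. 10, internal extremities)] -/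
structure Slot where
  /-- side of the open tip -/
  io : ℕ
  /-- scale index of the open tip -/
  jo : ℕ
  /-- window index of the open tip -/
  no : ℕ
  /-- side of the closed tip -/
  ic : ℕ
  /-- scale index of the closed tip -/
  jc : ℕ
  /-- window index of the closed tip -/
  nc : ℕ

namespace Slot

variable (P : LParams) (σ : Slot)

/-- scale of the open tip [folklore] -/
def ko : ℕ := trapScale P.k₀ σ.jo
/-- scale of the closed tip [folklore] -/
def kc : ℕ := trapScale P.k₀ σ.jc
/-- window start of the open tip [folklore] -/
def To : ℤ := P.T₀ σ.no
/-- window start of the closed tip [folklore] -/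
def Tc : ℤ := P.T₀ σ.nc
/-- lateral position of the beacon and spoke of the open tip (in its frame) [folklore] -/
def ξo : ℤ := σ.To P + 2 * σ.ko P + P.w
/-- lateral position of the beacon and spoke of the closed tip (in its frame) [folklore] -/
def ξc : ℤ := σ.Tc P + 2 * σ.kc P + P.w
/-- frame of the closed tip after colour exchange [folklore] -/
def ic' : ℕ := (σ.ic + 3) % 6

/-- **The danger zone** of the upper target row `t = tgtRow n true`: the lateral positions
`[t - n/64 - μ - 8s, t + n/64 + μ + 8s]` on the target's side; if the beacon of the other colour's
tip sits there (so that its slot box, spoke or ring window could meet the target boxes or the exit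
run), the lower target row is used instead. [folklore] -/
def Danger (ξ : ℤ) : Prop :=
  tgtRow P.n true - (P.n / 64 : ℕ) - P.μ - 8 * P.s ≤ ξ ∧ ξ ≤ tgtRow P.n true + (P.n / 64 : ℕ) + P.μ + 8 * P.s

/-- The danger zone is decidable. [folklore] -/
instance (ξ : ℤ) : Decidable (Danger P ξ) := by unfold Danger; infer_instance

/-- target row bit of the open arm: the upper row unless the closed tip sits on side `0` in its danger zone [folklore] -/
def bo : Bool := !decide (σ.ic = 0 ∧ Danger P (σ.ξc P))
/-- target row bit of the closed arm: the upper row unless the open tip sits on side `3` in its danger zone [folklore] -/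
def bc : Bool := !decide (σ.io = 3 ∧ Danger P (σ.ξo P))
/-- target row of the open arm [folklore] -/
def tgo : ℤ := tgtRow P.n (σ.bo P)
/-- target row of the closed arm (in the colour-exchanged picture) [folklore] -/
def tgc : ℤ := tgtRow P.n (σ.bc P)

/-- position of the entry piece of the open arm in ring `B` [folklore] -/
def gEo : ℕ := piecePos P.nB σ.io (latIdx P.s P.rB (σ.ξo P))
/-- position of the entry piece of the closed arm in ring `W` [folklore] -/
def gEc : ℕ := piecePos P.nW σ.ic' (latIdx P.s P.rW (σ.ξc P))

/-- lateral index of the white spoke on ring `B` [folklore] -/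
def ιc : ℕ := latIdx P.s P.rB (σ.ξc P)
/-- the window of ring `B` touched by the white spoke: first position [folklore] -/
def loB : ℕ := blockOff P.nB σ.ic + (if σ.ic % 3 = 2 then 2 * (P.nB - 2 - σ.ιc P) else 2 * (σ.ιc P - 1))
/-- the window of ring `B` touched by the white spoke: last position (six tubes: the pieces of
lateral index `ιc - 1, ιc, ιc + 1` and their connectors) [folklore] -/
def hiB : ℕ := σ.loB P + 5
/-- start of the arc of the open arm [folklore] -/
def aB : ℕ := σ.hiB P + 1

/-- lateral indices of the window of ring `W` touched by the black target boxes (side `3`) [folklore] -/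
def yLo : ℕ := latIdx P.s P.rW (σ.tgo P - (P.n / 64 : ℕ)) - 1
/-- lateral indices of the window of ring `W` touched by the black target boxes: last [folklore] -/
def yHi : ℕ := latIdx P.s P.rW (σ.tgo P + (P.n / 64 : ℕ)) + 1
/-- the window of ring `W`: first position [folklore] -/
def loW : ℕ := blockOff P.nW 3 + 2 * σ.yLo P
/-- the window of ring `W`: last position [folklore] -/
def hiW : ℕ := blockOff P.nW 3 + 2 * σ.yHi P + 1
/-- start of the arc of the closed arm [folklore] -/
def aW : ℕ := σ.hiW P + 1
/-- length of the arc of the closed arm [folklore] -/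
def lenW : ℕ := 12 * P.nW - 4 - (σ.hiW P - σ.loW P + 1)

/-- first piece of the exit run of the open arm (side `0` of ring `B`) [folklore] -/
def xo : ℕ := latIdx P.s P.rB (σ.tgo P)
/-- first piece of the exit run of the closed arm (side `0` of ring `W`) [folklore] -/
def xc : ℕ := latIdx P.s P.rW (σ.tgc P)

end Slot

/-! ### The four events of a slot -/

/-- **The beacon event** of a tip of the frame `i` at scale `k` in the window `[T₀, T₀ + w)`. [cite: Nolin2008, §4.3 Prop. 12 (proof) (arXiv 0711.4948: Prop. 11)] -/
def bcnEvent (i m k : ℕ) (T₀ : ℤ) (w : ℕ) : Set (SiteConfig (Site 2)) :=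
  {χ | frameConfig i χ ∈ triFrameAt (bcnCentre m k T₀ w) (k / 2)}

/-- **The corridor of one colour** in the normalised picture: beacon, spoke, arc, approach tube,
target free space. [cite: Nolin2008, §4.3 Prop. 12 (proof) (arXiv 0711.4948: Prop. 11)] -/
def corrEvent (i m n k : ℕ) (T₀ : ℤ) (w L ε r e s a len : ℕ) (t : ℤ) (W : ℕ) : Set (SiteConfig (Site 2)) :=
  bcnEvent i m k T₀ w ∩ spokeEvent i m k T₀ w L ε ∩ eventAll (arc (thinRing r e s) a len) ∩ tgtH n t W ∩ tgtV n t

namespace Slot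

variable (P : LParams) (σ : Slot)

/-- **The corridor of the open arm of the slot.** [cite: Nolin2008, §4.3 Prop. 12 (proof) (arXiv 0711.4948: Prop. 11)] -/
def blackCorr : Set (SiteConfig (Site 2)) :=
  corrEvent σ.io P.m P.n (σ.ko P) (σ.To P) P.w P.LB P.ε P.rB P.e P.s (σ.aB P) P.lenB (σ.tgo P) P.WB

/-- **The corridor of the closed arm of the slot** (through `negFlip`). [cite: Nolin2008, §4.3 Prop. 12 (proof) (arXiv 0711.4948: Prop. 11)] -/
def whiteCorr : Set (SiteConfig (Site 2)) :=
  negFlip ⁻¹' corrEvent σ.ic' P.m P.n (σ.kc P) (σ.Tc P) P.w P.LW P.ε P.rW P.e P.s (σ.aW P) (σ.lenW P) (σ.tgc P) P.WW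

/-- **The tiny-fenced open arm with tip in the slot**: outer free space at some
`zo ∈ sepLanding N`, and a fenced tip of the frame `io` at scale index `jo` with tip row in the
`no`-th window, far end attached to the outer crossing. [cite: Nolin2008, §4.4 (arXiv 0711.4948: Thm. 10, internal extremities)] -/
def blackArm : Set (SiteConfig (Site 2)) :=
  {ω | ∃ zo uo : Site 2, zo ∈ sepLanding P.N ∧
    OpenVCrossThrough (sepOuterFence P.N zo) (zo 1 - (P.N / 64 : ℕ)) (zo 1 + (P.N / 64 : ℕ)) ω uo ∧
    ∃ Fo : IntFencedArm P.m ((frameIso σ.io).symm '' (triAnnulusSet P.m P.N ∪ triOpenBall zo (P.N / 8))) P.k₀ P.K P.R₀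
      (frameConfig σ.io ω), Fo.j = σ.jo ∧ σ.To P ≤ Fo.z 1 ∧ Fo.z 1 < σ.To P + P.w ∧ Fo.b = (frameIso σ.io).symm uo}

/-- **The tiny-fenced closed arm with tip in the slot.** [cite: Nolin2008, §4.4 (arXiv 0711.4948: Thm. 10, internal extremities)] -/
def whiteArm : Set (SiteConfig (Site 2)) :=
  {ω | ∃ zc uc : Site 2, zc ∈ sepLanding P.N ∧
    OpenVCrossThrough (sepOuterFence P.N zc) (zc 1 - (P.N / 64 : ℕ)) (zc 1 + (P.N / 64 : ℕ)) (negFlip ω) uc ∧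
    ∃ Fc : IntFencedArm P.m ((frameIso σ.ic).symm '' (Neg.neg ⁻¹' (triAnnulusSet P.m P.N ∪ triOpenBall zc (P.N / 8)))) P.k₀ P.K P.R₀
      (frameConfig σ.ic ω)ᶜ, Fc.j = σ.jc ∧ σ.Tc P ≤ Fc.z 1 ∧ Fc.z 1 < σ.Tc P + P.w ∧ Fc.b = (frameIso σ.ic).symm (-uc)}

end Slot

/-! ### The slots cover the tiny-fenced two-arm event -/

/-- The windows cover the tip rows: every `t ∈ [-m, 0)` lies in the window of index
`⌊(t + m) / w⌋ < Nw` (`1 ≤ w`). [folklore] -/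
theorem exists_window (P : LParams) (hw : 1 ≤ P.w) {t : ℤ} (ht : -(P.m : ℤ) ≤ t) (ht0 : t < 0) :
    ∃ ν, ν < P.Nw ∧ P.T₀ ν ≤ t ∧ t < P.T₀ ν + P.w := by
  have h0 : (((t + P.m).toNat : ℕ) : ℤ) = t + P.m := by omega
  have h1 : (((t + P.m).toNat / P.w : ℕ) : ℤ) * P.w ≤ (t + P.m).toNat := by exact_mod_cast Nat.div_mul_le_self _ _
  have h2 : (((t + P.m).toNat : ℕ) : ℤ) < (((t + P.m).toNat / P.w : ℕ) : ℤ) * P.w + P.w := by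
    exact_mod_cast Nat.lt_div_mul_add hw
  refine ⟨(t + P.m).toNat / P.w, ?_, ?_, ?_⟩
  · unfold LParams.Nw
    have : (t + P.m).toNat ≤ P.m := by omega
    exact Nat.lt_succ_of_le (Nat.div_le_div_right this)
  · unfold LParams.T₀; omega
  · unfold LParams.T₀; omega

/-- **The slots cover the tiny-fenced two-arm event**: `IntTinyExt ⊆ ⋃_σ (blackArm σ ∩ whiteArm σ)`
over the slots with `io, ic < 6`, `jo, jc < K`, `no, nc < Nw` (`1 ≤ w`, `1 ≤ R₀`). [cite: Nolin2008, §4.4 (arXiv 0711.4948: Thm. 10, internal extremities)] -/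
theorem intTinyExt_subset_iUnion_slot (P : LParams) (hw : 1 ≤ P.w) (hR : 1 ≤ P.R₀) :
    IntTinyExt P.m P.N P.k₀ P.K P.R₀ ⊆ ⋃ σ ∈ {σ : Slot | σ.io < 6 ∧ σ.jo < P.K ∧ σ.no < P.Nw ∧ σ.ic < 6 ∧ σ.jc < P.K ∧ σ.nc < P.Nw},
      Slot.blackArm P σ ∩ Slot.whiteArm P σ := by
  intro ω hω
  obtain ⟨zo, uo, zc, uc, hzo, hzc, hOo, hOc, io, hio, ic, hic, ⟨Fo, hFo⟩, ⟨Fc, hFc⟩⟩ := hω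
  have hto : -(P.m : ℤ) ≤ Fo.z 1 ∧ Fo.z 1 < 0 := by
    have h : -(P.m : ℤ) + P.R₀ ≤ Fo.z 1 ∧ Fo.z 1 ≤ -(P.R₀ : ℤ) := Fo.z_mid
    omega
  have htc : -(P.m : ℤ) ≤ Fc.z 1 ∧ Fc.z 1 < 0 := by
    have h : -(P.m : ℤ) + P.R₀ ≤ Fc.z 1 ∧ Fc.z 1 ≤ -(P.R₀ : ℤ) := Fc.z_mid
    omega
  obtain ⟨no, hno, hno1, hno2⟩ := exists_window P hw hto.1 hto.2
  obtain ⟨nc, hnc, hnc1, hnc2⟩ := exists_window P hw htc.1 htc.2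
  simp only [Set.mem_iUnion, Set.mem_setOf_eq, exists_prop]
  refine ⟨⟨io, Fo.j, no, ic, Fc.j, nc⟩, ⟨hio, Fo.j_lt, hno, hic, Fc.j_lt, hnc⟩, ?_, ?_⟩
  · exact ⟨zo, uo, hzo, hOo, Fo, rfl, hno1, hno2, hFo⟩
  · exact ⟨zc, uc, hzc, hOc, Fc, rfl, hnc1, hnc2, hFc⟩

end Literature.Probability.Percolation
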